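import Summits.HodgeConjecture.HodgeConjecture.Theorems.Ring2WeilCoveragePfaffianForm
import Summits.HodgeConjecture.HodgeConjecture.Theorems.Ring2WeilCoverageNormTableB
import HarnessLib

/-!
# Ring 2 · Weil-type family-coverage census (ring2-b04, gen 41) — Pfaffian form of `det H`, part 2:
  the FIELD-BY-FIELD DICHOTOMIES for special fibres with a symmetry group of order `2ᵃ3ᵇ`

research route conditional on HC_CM; not a corollary; Q11.4-sentence-2 already refuted in dim ≥ 3.
`HC_CM` (`Theses.RankFourFaces.CMAbelianHodge`, by name) does not occur in this file; no case of the Hodge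
conjecture is claimed. Cell `pub-hodge-ring2`, seat `ring2-b04` (gen 41), census file `WEIL-FAMILY-COVERAGE.md`
§b04.5 (PLACEMENT LAW). Companion of `Ring2WeilCoveragePfaffianForm` (the identity
`det [[b, a], [-a, d b]] = (det Ψ)²` and `[det H] = [(-1)ⁿ c]` when that Gram determinant is `c²`).

When the symmetry group `G` of the special fibre has order `2ᵃ3ᵇ` (`Q₈`, the dicyclic group `Dic₃` of order 12,
`ℤ/3`, `ℤ/4`, `ℤ/6`), the census's lattice reading gives `c = [Λ:Λ₀]·d₁⋯d_{2n} = 2^α 3^β`. This file records, in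
the kernel, what that leaves for the discriminant class, field by field:

* `mk_pow_eq_one_or_eq_self`, `mk_pow_eq_one_of_mem` — the class of `pᵏ` is `1` or `[p]`, and is `1` if `p ∈ Nm(K_dˣ)`;
* `mk_det_eq_mk_neg_one_pow_mul_of_sq_mul` — if the Gram determinant is `(u·v)²` with `u ∈ Nm(K_dˣ)` then
  `[det H] = [(-1)ⁿ v]` (norm factors of `c` drop out);
* `mk_det_eq_split_or_three_of_sq_one` — **`K = ℚ(i)`, `c = 2^α 3^β`: the class is SPLIT or `[(-1)ⁿ·3]`**
  (`2 = 1² + 1²` is a norm) — the dicyclic-Prym dichotomy of the census (b01.10: «δ_F ∈ {1, 3}», pub-hsemireg row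
  R3 = `(3, ℚ(i), [3])` reachable, no other non-split `ℚ(i)`-row);
* `mk_det_eq_split_of_sq_two_pow_three_pow_two` — **`K = ℚ(√-2)`: always SPLIT** (`2 = 0² + 2·1²`, `3 = 1² + 2·1²`);
* `mk_det_eq_split_or_two_of_sq_three` — **`K = ℚ(√-3)`: SPLIT or `[(-1)ⁿ·2]`** (`3 = 0² + 3·1²` is a norm) — the
  `Q₈` / `ℤ/6` dichotomy (b01.9 law (E), b06.5 (B)(ii): row `W(2n).3.2` = pub-hsemireg R1 or the split row);
* `mk_det_eq_split_or_three_of_sq_seven` — **`K = ℚ(√-7)`: SPLIT or `[(-1)ⁿ·3]`** (`2 = (1/2)² + 7(1/2)²` is a norm) —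
  b01.10's `W6.7.3` / `W8.7.3` / `W10.7.3`.

Sorry-free; axioms standard; no `def`, no named fact; the norm memberships are ring2-b04 gen 40's table entries
`SqrtNeg1.mem_2`, `SqrtNeg2.mem_2/mem_3`, `SqrtNeg3.mem_3`, `SqrtNeg7.mem_2` (reused by name).

## References

* [vanGeemen1994HodgeAV] B. van Geemen, LNM 1594 (1994), Lemma 5.2 (3), 5.4 and (5.4.1).
* [LangeBirkenhake1992] H. Lange, Ch. Birkenhake, Complex Abelian Varieties (1992), §3.1, §5.3.
-/

noncomputable section

set_option linter.dupNamespace false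

open Matrix
open Literature.AlgebraicGeometry.Motives (normUnitsSubgroup)
open Literature.AlgebraicGeometry.VanGeemen1994
open Summit.HodgeConjecture.HodgeConjecture.Ring2.Hypotheses
open Summit.HodgeConjecture.HodgeConjecture.Ring2.AbelianAll (weilStdGramMatrix)

namespace Summit.HodgeConjecture.HodgeConjecture.Ring2.WeilCoverage

/-! ### §1 Classes of prime powers -/

/-- In `ℚˣ/Nm(K_dˣ)` the class of `pᵏ` is `1` (`k` even) or `[p]` (`k` odd).
research route conditional on HC_CM; not a corollary; Q11.4-sentence-2 already refuted in dim ≥ 3. [folklore] -/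
theorem mk_pow_eq_one_or_eq_self (d : ℕ) {p : ℚ} (hp : p ≠ 0) (k : ℕ) :
    (QuotientGroup.mk (Units.mk0 (p ^ k) (pow_ne_zero k hp)) : weilNormResidueGroup d) = 1 ∨
      (QuotientGroup.mk (Units.mk0 (p ^ k) (pow_ne_zero k hp)) : weilNormResidueGroup d) =
        QuotientGroup.mk (Units.mk0 p hp) := by
  rcases Nat.even_or_odd k with ⟨j, rfl⟩ | ⟨j, rfl⟩
  · left
    have hx : Units.mk0 (p ^ (j + j)) (pow_ne_zero (j + j) hp) =
        Units.mk0 ((p ^ j) ^ 2) (pow_ne_zero 2 (pow_ne_zero j hp)) := by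
      ext
      simp only [Units.val_mk0]
      ring
    rw [hx]
    exact (QuotientGroup.eq_one_iff _).mpr (sq_mem_normUnitsSubgroup (pow_ne_zero j hp))
  · right
    have hx : Units.mk0 (p ^ (2 * j + 1)) (pow_ne_zero (2 * j + 1) hp) =
        Units.mk0 ((p ^ j) ^ 2) (pow_ne_zero 2 (pow_ne_zero j hp)) * Units.mk0 p hp := by
      ext
      simp only [Units.val_mk0, Units.val_mul]
      ring
    rw [hx, QuotientGroup.mk_mul, (QuotientGroup.eq_one_iff _).mpr (sq_mem_normUnitsSubgroup (pow_ne_zero j hp)),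
      one_mul]

/-- If `p ∈ Nm(K_dˣ)` then every power `pᵏ` has the trivial class.
research route conditional on HC_CM; not a corollary; Q11.4-sentence-2 already refuted in dim ≥ 3. [folklore] -/
theorem mk_pow_eq_one_of_mem (d : ℕ) {p : ℚ} (hp : p ≠ 0)
    (hmem : Units.mk0 p hp ∈ normUnitsSubgroup ℚ (weilField d)) (k : ℕ) :
    (QuotientGroup.mk (Units.mk0 (p ^ k) (pow_ne_zero k hp)) : weilNormResidueGroup d) = 1 := by
  have hx : Units.mk0 (p ^ k) (pow_ne_zero k hp) = (Units.mk0 p hp) ^ k := by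
    ext
    simp
  rw [hx]
  exact (QuotientGroup.eq_one_iff _).mpr (Subgroup.pow_mem _ hmem k)

/-! ### §2 Norm factors of `c` drop out of the class -/

section Census

variable {n d : ℕ} {a b : Matrix (Fin (2 * n)) (Fin (2 * n)) ℚ} {q : ℚ}

/-- **Norm factors drop out.** If the rational Gram determinant of `E` on `{xᵢ, φ^*xᵢ}` is `(u·v)²` with `u, v > 0`
and `u ∈ Nm(K_dˣ)`, and `det Ψ = q` has the Weil-type sign, then `[det H] = [(-1)ⁿ·v]`.
research route conditional on HC_CM; not a corollary; Q11.4-sentence-2 already refuted in dim ≥ 3.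
[cite: vanGeemen1994HodgeAV, Lemma 5.2 (3) and (5.4.1)] -/
theorem mk_det_eq_mk_neg_one_pow_mul_of_sq_mul (hd : 0 < d) (ha : a.IsSymm) (hb : bᵀ = -b)
    (hq : (weilGramMatrix d a b).det = algebraMap ℚ (weilField d) q) {u v : ℚ} (hu : 0 < u) (hv : 0 < v)
    (hc : (weilStdGramMatrix n d a b).det = (u * v) ^ 2)
    (hmem : Units.mk0 u hu.ne' ∈ normUnitsSubgroup ℚ (weilField d)) (hsign : 0 < (-1 : ℚ) ^ n * q)
    (hq0 : q ≠ 0) :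
    (QuotientGroup.mk (Units.mk0 q hq0) : weilNormResidueGroup d) =
      QuotientGroup.mk ((-1 : ℚˣ) ^ n * Units.mk0 v hv.ne') := by
  rw [mk_det_eq_mk_neg_one_pow_mul_of_sq hd ha hb hq hc (mul_pos hu hv) hsign hq0,
    ← mk0_mul_mk0 hu.ne' hv.ne', ← mul_assoc, mul_right_comm, QuotientGroup.mk_mul,
    (QuotientGroup.eq_one_iff _).mpr hmem, mul_one]

/-- Bookkeeping: the class `[(-1)ⁿ·pᵏ]` is the split class or `[(-1)ⁿ·p]`.
research route conditional on HC_CM; not a corollary; Q11.4-sentence-2 already refuted in dim ≥ 3. [folklore] -/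
theorem mk_neg_one_pow_mul_pow_eq_split_or (d n : ℕ) {p : ℚ} (hp : p ≠ 0) (k : ℕ) :
    (QuotientGroup.mk ((-1 : ℚˣ) ^ n * Units.mk0 (p ^ k) (pow_ne_zero k hp)) : weilNormResidueGroup d) =
        splitDiscriminantClass n d ∨
      (QuotientGroup.mk ((-1 : ℚˣ) ^ n * Units.mk0 (p ^ k) (pow_ne_zero k hp)) : weilNormResidueGroup d) =
        QuotientGroup.mk ((-1 : ℚˣ) ^ n * Units.mk0 p hp) := by
  rw [QuotientGroup.mk_mul, QuotientGroup.mk_mul]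
  rcases mk_pow_eq_one_or_eq_self d hp k with h | h
  · left
    rw [h, mul_one]
  · right
    rw [h]

/-! ### §3 The dichotomies, field by field (`c = 2^α · 3^β`: symmetry groups of order `2ᵃ3ᵇ`) -/

/-- **`K = ℚ(i)`: `c = 2^α 3^β` ⟹ SPLIT or `[(-1)ⁿ·3]`** (`2 ∈ Nm(ℚ(i)ˣ)`). Dicyclic (`Dic₃`, order 12) Pryms
over `ℚ(i)`: the census's dichotomy «`a ∈ {1, 3}`», pub-hsemireg row R3 = `(3, ℚ(i), [3])`.
research route conditional on HC_CM; not a corollary; Q11.4-sentence-2 already refuted in dim ≥ 3.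
[cite: vanGeemen1994HodgeAV, 5.4 and (5.4.1)] -/
theorem mk_det_eq_split_or_three_of_sq_one {a b : Matrix (Fin (2 * n)) (Fin (2 * n)) ℚ} (ha : a.IsSymm)
    (hb : bᵀ = -b) (hq : (weilGramMatrix 1 a b).det = algebraMap ℚ (weilField 1) q) {α β : ℕ}
    (hc : (weilStdGramMatrix n 1 a b).det = ((2 : ℚ) ^ α * 3 ^ β) ^ 2) (hsign : 0 < (-1 : ℚ) ^ n * q)
    (hq0 : q ≠ 0) :
    (QuotientGroup.mk (Units.mk0 q hq0) : weilNormResidueGroup 1) = splitDiscriminantClass n 1 ∨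
      (QuotientGroup.mk (Units.mk0 q hq0) : weilNormResidueGroup 1) =
        QuotientGroup.mk ((-1 : ℚˣ) ^ n * Units.mk0 (3 : ℚ) three_ne_zero) := by
  rw [mk_det_eq_mk_neg_one_pow_mul_of_sq_mul one_pos ha hb hq (by positivity) (by positivity) hc
    (two_pow_mem_normUnitsSubgroup_one α) hsign hq0]
  exact mk_neg_one_pow_mul_pow_eq_split_or 1 n three_ne_zero β

/-- **`K = ℚ(√-2)`: `c = 2^α 3^β` ⟹ SPLIT** (`2 = 0² + 2·1²` and `3 = 1² + 2·1²` are norms): no special fibre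
with a symmetry group of order `2ᵃ3ᵇ` lies on a non-split `ℚ(√-2)`-row.
research route conditional on HC_CM; not a corollary; Q11.4-sentence-2 already refuted in dim ≥ 3.
[cite: vanGeemen1994HodgeAV, 5.4 and (5.4.1)] -/
theorem mk_det_eq_split_of_sq_two_pow_three_pow_two {a b : Matrix (Fin (2 * n)) (Fin (2 * n)) ℚ}
    (ha : a.IsSymm) (hb : bᵀ = -b) (hq : (weilGramMatrix 2 a b).det = algebraMap ℚ (weilField 2) q)
    {α β : ℕ} (hc : (weilStdGramMatrix n 2 a b).det = ((2 : ℚ) ^ α * 3 ^ β) ^ 2)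
    (hsign : 0 < (-1 : ℚ) ^ n * q) (hq0 : q ≠ 0) :
    (QuotientGroup.mk (Units.mk0 q hq0) : weilNormResidueGroup 2) = splitDiscriminantClass n 2 := by
  rw [mk_det_eq_mk_neg_one_pow_mul_of_sq_mul two_pos ha hb hq (by positivity) (by positivity) hc
    (two_pow_mem_normUnitsSubgroup_two α) hsign hq0, QuotientGroup.mk_mul,
    mk_pow_eq_one_of_mem 2 three_ne_zero SqrtNeg2.mem_3 β, mul_one]

/-- **`K = ℚ(√-3)`: `c = 2^α 3^β` ⟹ SPLIT or `[(-1)ⁿ·2]`** (`3 = 0² + 3·1² ∈ Nm(ℚ(√-3)ˣ)`). Quaternionic (`Q₈`)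
and `ℤ/6`-Prym pieces over `ℚ(√-3)`: the census's dichotomy «`a ∈ {1, 2}`», non-split row `W(2n).3.2` =
pub-hsemireg R1.
research route conditional on HC_CM; not a corollary; Q11.4-sentence-2 already refuted in dim ≥ 3.
[cite: vanGeemen1994HodgeAV, 5.4 and (5.4.1)] -/
theorem mk_det_eq_split_or_two_of_sq_three {a b : Matrix (Fin (2 * n)) (Fin (2 * n)) ℚ} (ha : a.IsSymm)
    (hb : bᵀ = -b) (hq : (weilGramMatrix 3 a b).det = algebraMap ℚ (weilField 3) q) {α β : ℕ}
    (hc : (weilStdGramMatrix n 3 a b).det = ((2 : ℚ) ^ α * 3 ^ β) ^ 2) (hsign : 0 < (-1 : ℚ) ^ n * q)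
    (hq0 : q ≠ 0) :
    (QuotientGroup.mk (Units.mk0 q hq0) : weilNormResidueGroup 3) = splitDiscriminantClass n 3 ∨
      (QuotientGroup.mk (Units.mk0 q hq0) : weilNormResidueGroup 3) =
        QuotientGroup.mk ((-1 : ℚˣ) ^ n * Units.mk0 (2 : ℚ) two_ne_zero) := by
  have hc' : (weilStdGramMatrix n 3 a b).det = ((3 : ℚ) ^ β * 2 ^ α) ^ 2 := by rw [hc, mul_comm]
  rw [mk_det_eq_mk_neg_one_pow_mul_of_sq_mul three_pos ha hb hq (by positivity) (by positivity) hc'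
    (mk_pow_mem_three β) hsign hq0]
  exact mk_neg_one_pow_mul_pow_eq_split_or 3 n two_ne_zero α
where
  /-- `3^β ∈ Nm(ℚ(√-3)ˣ)`. [cite: vanGeemen1994HodgeAV, (5.4.1)] -/
  mk_pow_mem_three (β : ℕ) :
      Units.mk0 ((3 : ℚ) ^ β) (pow_ne_zero β three_ne_zero) ∈ normUnitsSubgroup ℚ (weilField 3) := by
    have hx : Units.mk0 ((3 : ℚ) ^ β) (pow_ne_zero β three_ne_zero) = (Units.mk0 (3 : ℚ) three_ne_zero) ^ β := by
      ext
      simp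
    rw [hx]
    exact Subgroup.pow_mem _ SqrtNeg3.mem_3 β

/-- **`K = ℚ(√-7)`: `c = 2^α 3^β` ⟹ SPLIT or `[(-1)ⁿ·3]`** (`2 = (1/2)² + 7·(1/2)² ∈ Nm(ℚ(√-7)ˣ)`). Dicyclic Pryms
over `ℚ(√-7) ⊂ (-1,-3)_ℚ`: the census's rows `W6.7.3`, `W8.7.3`, `W10.7.3` or the split row, nothing else.
research route conditional on HC_CM; not a corollary; Q11.4-sentence-2 already refuted in dim ≥ 3.
[cite: vanGeemen1994HodgeAV, 5.4 and (5.4.1)] -/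
theorem mk_det_eq_split_or_three_of_sq_seven {a b : Matrix (Fin (2 * n)) (Fin (2 * n)) ℚ} (ha : a.IsSymm)
    (hb : bᵀ = -b) (hq : (weilGramMatrix 7 a b).det = algebraMap ℚ (weilField 7) q) {α β : ℕ}
    (hc : (weilStdGramMatrix n 7 a b).det = ((2 : ℚ) ^ α * 3 ^ β) ^ 2) (hsign : 0 < (-1 : ℚ) ^ n * q)
    (hq0 : q ≠ 0) :
    (QuotientGroup.mk (Units.mk0 q hq0) : weilNormResidueGroup 7) = splitDiscriminantClass n 7 ∨
      (QuotientGroup.mk (Units.mk0 q hq0) : weilNormResidueGroup 7) =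
        QuotientGroup.mk ((-1 : ℚˣ) ^ n * Units.mk0 (3 : ℚ) three_ne_zero) := by
  rw [mk_det_eq_mk_neg_one_pow_mul_of_sq_mul (by norm_num : 0 < 7) ha hb hq (by positivity) (by positivity) hc
    (mk_pow_mem_seven α) hsign hq0]
  exact mk_neg_one_pow_mul_pow_eq_split_or 7 n three_ne_zero β
where
  /-- `2^α ∈ Nm(ℚ(√-7)ˣ)`. [cite: vanGeemen1994HodgeAV, (5.4.1)] -/
  mk_pow_mem_seven (α : ℕ) :
      Units.mk0 ((2 : ℚ) ^ α) (pow_ne_zero α two_ne_zero) ∈ normUnitsSubgroup ℚ (weilField 7) := by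
    have hx : Units.mk0 ((2 : ℚ) ^ α) (pow_ne_zero α two_ne_zero) = (Units.mk0 (2 : ℚ) two_ne_zero) ^ α := by
      ext
      simp
    rw [hx]
    exact Subgroup.pow_mem _ SqrtNeg7.mem_2 α

end Census

end Summit.HodgeConjecture.HodgeConjecture.Ring2.WeilCoverage

end
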